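import Summits.BirchSwinnertonDyer.BirchSwinnertonDyer.Theses.SylvesterTwoHeegnerIndex
import Summits.BirchSwinnertonDyer.Rank1Residual.X12.CubeSumSylvesterAtTwo
import Summits.BirchSwinnertonDyer.Rank1Residual.P2.CMRankOneAtTwoHeegnerIndexHalves
import HarnessLib

/-!
# Route `SylvesterTwoHeegnerIndex` (rung K7t), crux `HeegnerIndexUpperAtTwoHSY` (item 19229):
# CONTENT DISCLOSURE — modulo the route's own support item the crux is EXACTLY the Euler-system half
# `MissingUpperBoundAt W 2` of `BSD(E_p, 2)` on 𝒞_HSY; per-member instances from `BSD(E_p, 2)`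

HONEST FRAMING (cell «bsd-cm», `run/shared/lean/pub/bsd-cm/`, D-0033 tranche 1a; D-0074 seat
`bsd-cm-k7t-c2`, item stmt-BirchSwinnertonDyer-19229): the crux
`HeegnerIndexUpperAtTwoHSY` — `ord₂ #Ш(E_p) ≤ ord₂ 𝔮(E_p, K, P, c, k, Wd, u)` for every globally minimal
model of a Sylvester curve `E_p : x³ + y³ = p` (`p ≡ 4, 7 (mod 9)` prime, `3 ∉ 𝔽_p^{×3}`) in every
Heegner frame — is the KOLYVAGIN DIRECTION of `BSD(E_p, 2)` and is OPEN AS A CLASS (B14 = O12; no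
theorem in print: Kolyvagin 1990 / Matar–Nekovář 2019 Thm 0.3 need `p` odd, Kolyvagin ICM 1990 §2 has
an `E`-dependent constant at `2`). This file proves NO case of it at class level. It records, sorry-free
and over the tree's named published facts taken as explicit binders (nothing asserted, nothing booked):

* `heegnerIndexUpperAtTwoHSY_of_cmRankOneHeegnerIndexUpperAtTwo` — the crux is the RESTRICTION to
  𝒞_HSY of the cell's typed Euler-system half `P2.CMRankOneHeegnerIndexUpperAtTwo`.
* `upperInstance_of_missingUpperBoundAt` — at ONE member `W` and ONE frame, the crux's inequality
  follows from the cell's typed half `Typed.MissingUpperBoundAt W 2` (Gross–Zagier, Kolyvagin, GZK,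
  modularity, Burungale–Flach for the twin: the landed `P2.missingHalves_two_iff_cmHeegnerIndex`, with
  the halvability bit `k` pinned by its defining `iff`).
* `heegnerIndexUpperAtTwoHSY_of_missingUpperBoundAt` / `missingUpperBoundAt_of_heegnerIndexUpperAtTwoHSY`
  / **`heegnerIndexUpperAtTwoHSY_iff_missingUpperBoundAt`** — granted `PublishedFactsTwo` (the route's
  support item 19231) the crux is EQUIVALENT to `∀` members, `MissingUpperBoundAt W 2`: the crux is
  fact-free as typed, carries no frame-dependence beyond BSD₂'s upper half, and its open content is
  exactly «`ord₂ #Ш(E_p) ≤ ord₂ #Ш_an(E_p)` on 𝒞_HSY».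
* `upperInstance_of_bsdp_two` — per member, `BSD(W, 2)` gives the crux's inequality in every frame
  (the shape of a T3 witness; `BSD(E_p, 2)` itself is certified per pair by the lane, never in-kernel;
  the PRINT instances `p = 7, 13` of conductor `< 5000` (Creutz–Miller 2012) are the sequel file
  `SylvesterTwoHeegnerIndexUpperInstances.lean`).

WHAT THIS IS NOT: not a proof of the crux for any `p`; not a Kolyvagin argument at `2`; the class
statement stays OPEN. References: [Kolyvagin1990] Thm A; [MatarNekovar2019] Thm 0.3, §0.11;
[HuShuYin2019] Thm 1.3/1.4; [BurungaleFlach2024] Thm 1.1, Cor. 2; [Miller2011LMS] Def. 1.1; parents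
`P2/CMRankOneAtTwoHeegnerIndex(Halves).lean` (p396383), `X12/CubeSumSylvesterAtTwo.lean`,
`Theorems/CMRungInputs.lean` (p406906).
-/

set_option autoImplicit false
set_option linter.dupNamespace false

noncomputable section

open scoped Classical

open WeierstrassCurve NumberField Literature.NumberTheory.EllipticCurves
  Literature.NumberTheory.EllipticCurves.ModularForms
  Literature.NumberTheory.EllipticCurves.Rank1Residual
  Literature.NumberTheory.EllipticCurves.Rank1Residual.Typed
  Literature.NumberTheory.EllipticCurves.HuShuYin2019
  Summit.BirchSwinnertonDyer.Rank1Residual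
  Summit.BirchSwinnertonDyer.Rank1Residual.P2
  Summit.BirchSwinnertonDyer.BirchSwinnertonDyer.Theses.SylvesterTwoHeegnerIndex

namespace Summit.BirchSwinnertonDyer.BirchSwinnertonDyer.Theorems.SylvesterTwoUpper

/-! ## §1 The crux is the restriction of the cell's typed Euler-system half -/

/-- **The crux is the restriction to 𝒞_HSY of `P2.CMRankOneHeegnerIndexUpperAtTwo`** (the cell's
typed Euler-system half for EVERY CM curve of analytic rank one): the crux carries `W.HasCM` and
`W.analyticRank = 1` among its hypotheses, so the restriction is literal. (Both sides OPEN; nothing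
asserted.) [cite: Kolyvagin1990, Thm. A] [cite: MatarNekovar2019, Thm. 0.3 and §0.11] -/
theorem heegnerIndexUpperAtTwoHSY_of_cmRankOneHeegnerIndexUpperAtTwo
    (h : CMRankOneHeegnerIndexUpperAtTwo) : HeegnerIndexUpperAtTwoHSY := by
  intro p _hp _h9 _h3 W _ _ _hW N _ K _ _ Dt H ι P Wd _ _ Cd k hcm hr hK hHN hP hLt hWd hk12 hkiff
  exact h W N K Dt H ι P Wd Cd k hcm hr hK hHN hP hLt hWd hk12 hkiff

/-! ## §2 One member, one frame: the inequality from the typed half `MissingUpperBoundAt W 2` -/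

section Frame

variable (W : WeierstrassCurve ℚ) [W.IsElliptic] [W.IsGloballyMinimal]
  (N : ℕ) [NeZero N] (K : Type) [Field K] [NumberField K]
  (Dt : ModularParametrizationData W N) (H : HeegnerDatum N (NumberField.discr K)) (ι : K →+* ℂ)
  (P : (W.baseChange K).toAffine.Point)

/-- **Per member, per frame: `MissingUpperBoundAt W 2` ⇒ the crux's inequality.** For a globally
minimal CM `W` of analytic rank one and ANY Heegner frame `(N, K, Dt, H, ι, P, Wd, Cd, k)` as in the
crux, the cell's typed half `ord₂ #Ш(W) ≤ ord₂ #Ш_an(W)` gives `ord₂ #Ш(W) ≤ ord₂ 𝔮(W, K, P, c, k, Wd, u)`: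
`#Ш_an(W) = 𝔮` by the landed `L`-free identity (`P2.missingHalves_two_iff_cmHeegnerIndex`: Gross–Zagier
`hGZ`, Kolyvagin `hKo`, GZK `hGZK`, modularity `hmod`, Burungale–Flach `hBF`), the halvability value `k`
of the frame being pinned by its defining `iff`. [cite: BurungaleFlach2024, Thm. 1.1 and Cor. 2]
[cite: Miller2011LMS, Def. 1.1] -/
theorem upperInstance_of_missingUpperBoundAt
    (hGZ : gross_zagier N W K) (hKo : kolyvagin N W K)
    (hGZK : rank_eq_analyticRank_of_analyticRank_le_one) (hmod : hasEntireLFunction_rat)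
    (hBF : bsdTriple_of_hasCM_of_L_one_ne_zero)
    (hcm : W.HasCM) (hr : W.analyticRank = 1) (hK : IsImaginaryQuadratic K)
    (hHN : SatisfiesHeegnerHypothesis N K)
    (hP : WeierstrassCurve.Affine.Point.map ι.toRatAlgHom P = heegnerPointComplex Dt H)
    (hLt : (W.quadraticTwist (NumberField.discr K : ℚ)).entireLFunction 1 ≠ 0)
    (Wd : WeierstrassCurve ℚ) [Wd.IsElliptic] [Wd.IsGloballyMinimal] (Cd : VariableChange ℚ)
    (hWd : Cd • W.quadraticTwist (NumberField.discr K : ℚ) = Wd) (k : ℕ) (hk12 : k = 1 ∨ k = 2)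
    (hkiff : k = 2 ↔ ∀ y : W.toAffine.Point, ∃ Q : (W.baseChange K).toAffine.Point,
      QuadraticDescent.incl K W y - (2 : ℤ) • Q ∈ AddCommGroup.torsion (W.baseChange K).toAffine.Point)
    (hu : MissingUpperBoundAt W 2) :
    (padicValNat 2 (Nat.card W.sha) : ℤ) ≤ padicValRat 2 (cmHeegnerIndexQuotient W K P Dt.c k Wd Cd.u) := by
  obtain ⟨k', hk12', hkiff', -, hupiff⟩ := missingHalves_two_iff_cmHeegnerIndex W N K Dt H ι P
    hGZ hKo hGZK hmod hBF hcm hK hHN hP hr hLt Wd Cd hWd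
  -- the halvability bit pins `k`: `k = k'`
  have hkk : k = k' := by
    rcases hk12 with rfl | rfl <;> rcases hk12' with rfl | rfl
    · rfl
    · exact absurd (hkiff.mpr (hkiff'.mp rfl)) (by decide)
    · exact absurd (hkiff'.mpr (hkiff.mp rfl)) (by decide)
    · rfl
  subst hkk
  exact hupiff.mp hu

/-- **Conversely, per member: the crux's inequality in ONE frame ⇒ `MissingUpperBoundAt W 2`**
(same named facts): the frame's `𝔮` IS `#Ш_an(W)`. [cite: BurungaleFlach2024, Thm. 1.1 and Cor. 2]
[cite: Miller2011LMS, Def. 1.1] -/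
theorem missingUpperBoundAt_of_upperInstance
    (hGZ : gross_zagier N W K) (hKo : kolyvagin N W K)
    (hGZK : rank_eq_analyticRank_of_analyticRank_le_one) (hmod : hasEntireLFunction_rat)
    (hBF : bsdTriple_of_hasCM_of_L_one_ne_zero)
    (hcm : W.HasCM) (hr : W.analyticRank = 1) (hK : IsImaginaryQuadratic K)
    (hHN : SatisfiesHeegnerHypothesis N K)
    (hP : WeierstrassCurve.Affine.Point.map ι.toRatAlgHom P = heegnerPointComplex Dt H)
    (hLt : (W.quadraticTwist (NumberField.discr K : ℚ)).entireLFunction 1 ≠ 0)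
    (Wd : WeierstrassCurve ℚ) [Wd.IsElliptic] [Wd.IsGloballyMinimal] (Cd : VariableChange ℚ)
    (hWd : Cd • W.quadraticTwist (NumberField.discr K : ℚ) = Wd) (k : ℕ) (hk12 : k = 1 ∨ k = 2)
    (hkiff : k = 2 ↔ ∀ y : W.toAffine.Point, ∃ Q : (W.baseChange K).toAffine.Point,
      QuadraticDescent.incl K W y - (2 : ℤ) • Q ∈ AddCommGroup.torsion (W.baseChange K).toAffine.Point)
    (hle : (padicValNat 2 (Nat.card W.sha) : ℤ) ≤
      padicValRat 2 (cmHeegnerIndexQuotient W K P Dt.c k Wd Cd.u)) :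
    MissingUpperBoundAt W 2 := by
  obtain ⟨k', hk12', hkiff', -, hupiff⟩ := missingHalves_two_iff_cmHeegnerIndex W N K Dt H ι P
    hGZ hKo hGZK hmod hBF hcm hK hHN hP hr hLt Wd Cd hWd
  have hkk : k = k' := by
    rcases hk12 with rfl | rfl <;> rcases hk12' with rfl | rfl
    · rfl
    · exact absurd (hkiff.mpr (hkiff'.mp rfl)) (by decide)
    · exact absurd (hkiff'.mpr (hkiff.mp rfl)) (by decide)
    · rfl
  subst hkk
  exact hupiff.mpr hle

/-- **Per member: `BSD(W, 2)` ⇒ the crux's inequality in EVERY frame** — the shape in which a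
per-pair certificate (the lane's certified `#Ш(E_p) = #Ш_an(E_p)`, never in-kernel) or a published
`BSD(E_p, 2)` witnesses the crux at one member: `BSD(W, 2)` with `Ш(W)` finite (GZK, `hGZK`) is
`MissingPPartAt W 2` (`Typed.missingPPartAt_of_bsdp`), whose upper half feeds
`upperInstance_of_missingUpperBoundAt`. [cite: Miller2011LMS, Def. 1.1] [cite: Darmon2004, Thm. 3.22] -/
theorem upperInstance_of_bsdp_two
    (hGZ : gross_zagier N W K) (hKo : kolyvagin N W K)
    (hGZK : rank_eq_analyticRank_of_analyticRank_le_one) (hmod : hasEntireLFunction_rat)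
    (hBF : bsdTriple_of_hasCM_of_L_one_ne_zero)
    (hcm : W.HasCM) (hr : W.analyticRank = 1) (hK : IsImaginaryQuadratic K)
    (hHN : SatisfiesHeegnerHypothesis N K)
    (hP : WeierstrassCurve.Affine.Point.map ι.toRatAlgHom P = heegnerPointComplex Dt H)
    (hLt : (W.quadraticTwist (NumberField.discr K : ℚ)).entireLFunction 1 ≠ 0)
    (Wd : WeierstrassCurve ℚ) [Wd.IsElliptic] [Wd.IsGloballyMinimal] (Cd : VariableChange ℚ)
    (hWd : Cd • W.quadraticTwist (NumberField.discr K : ℚ) = Wd) (k : ℕ) (hk12 : k = 1 ∨ k = 2)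
    (hkiff : k = 2 ↔ ∀ y : W.toAffine.Point, ∃ Q : (W.baseChange K).toAffine.Point,
      QuadraticDescent.incl K W y - (2 : ℤ) • Q ∈ AddCommGroup.torsion (W.baseChange K).toAffine.Point)
    (hb : BSDp W 2) :
    (padicValNat 2 (Nat.card W.sha) : ℤ) ≤ padicValRat 2 (cmHeegnerIndexQuotient W K P Dt.c k Wd Cd.u) := by
  haveI : Fact (2 : ℕ).Prime := ⟨Nat.prime_two⟩
  haveI : Finite W.sha := (hGZK W (by rw [hr])).2
  exact upperInstance_of_missingUpperBoundAt W N K Dt H ι P hGZ hKo hGZK hmod hBF hcm hr hK hHN hP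
    hLt Wd Cd hWd k hk12 hkiff (lower_and_upper_of_missingPPartAt W 2 (missingPPartAt_of_bsdp W 2 hb)).2

end Frame

/-! ## §3 The class statement: crux ⟺ the Euler-system half of BSD(E_p, 2) on 𝒞_HSY -/

/-- **`∀` members, `MissingUpperBoundAt W 2` ⇒ the crux** (Gross–Zagier, Kolyvagin, GZK, modularity,
Burungale–Flach as binders; the crux's own hypothesis `W.analyticRank = 1` is used, so Hu–Shu–Yin is
not needed in this direction). [cite: BurungaleFlach2024, Thm. 1.1 and Cor. 2] [cite: Miller2011LMS, Def. 1.1] -/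
theorem heegnerIndexUpperAtTwoHSY_of_missingUpperBoundAt
    (hGZ : ∀ (N : ℕ) [NeZero N] (W : WeierstrassCurve ℚ) (K : Type) [Field K] [NumberField K],
      gross_zagier N W K)
    (hKo : ∀ (N : ℕ) [NeZero N] (W : WeierstrassCurve ℚ) (K : Type) [Field K] [NumberField K],
      kolyvagin N W K)
    (hGZK : rank_eq_analyticRank_of_analyticRank_le_one) (hmod : hasEntireLFunction_rat)
    (hBF : bsdTriple_of_hasCM_of_L_one_ne_zero)
    (h : ∀ (p : ℕ), p.Prime → (p % 9 = 4 ∨ p % 9 = 7) → (¬ ∃ x : ZMod p, x ^ 3 = 3) →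
      ∀ (W : WeierstrassCurve ℚ) [W.IsElliptic] [W.IsGloballyMinimal],
        (∃ C : VariableChange ℚ, C • W = cubeSumCurve (p : ℚ)) → MissingUpperBoundAt W 2) :
    HeegnerIndexUpperAtTwoHSY := by
  intro p hp h9 h3 W _ _ hW N _ K _ _ Dt H ι P Wd _ _ Cd k hcm hr hK hHN hP hLt hWd hk12 hkiff
  exact upperInstance_of_missingUpperBoundAt W N K Dt H ι P (hGZ N W K) (hKo N W K) hGZK hmod hBF
    hcm hr hK hHN hP hLt Wd Cd hWd k hk12 hkiff (h p hp h9 h3 W hW)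

/-- **The crux ⇒ `∀` members, `MissingUpperBoundAt W 2`.** For a globally minimal model `W` of `E_p`
a Heegner frame EXISTS by the published facts (analytic rank one and CM from Hu–Shu–Yin Thm 1.3 +
Burungale–Flach (`X12.CubeSumFamilies.bsdp_three_of_thm14'`, `X12.Sylvester.hasCM_of_model`); sign `−1`
by parity; a Heegner field `K` with `L(W^{(d_K)}, 1) ≠ 0` by Waldspurger–BFH; a Heegner point over `K`;
a globally minimal model of the twin), and in that frame the crux's inequality is `MissingUpperBoundAt W 2`
(`missingUpperBoundAt_of_upperInstance`). Pattern of `P2.missingUpperBoundAt_two_of_upper`.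
[cite: Darmon2004, §3.9, proof of Thm. 3.22] [cite: HuShuYin2019, Thm. 1.3 and Thm. 1.4 (p. 3)]
[cite: BurungaleFlach2024, Thm. 1.1 and Cor. 2] -/
theorem missingUpperBoundAt_of_heegnerIndexUpperAtTwoHSY
    (hHSY : thm14_threePart_product) (hBF : bsdTriple_of_hasCM_of_L_one_ne_zero)
    (hmod : hasEntireLFunction_rat)
    (hGZ : ∀ (N : ℕ) [NeZero N] (W : WeierstrassCurve ℚ) (K : Type) [Field K] [NumberField K],
      gross_zagier N W K)
    (hKo : ∀ (N : ℕ) [NeZero N] (W : WeierstrassCurve ℚ) (K : Type) [Field K] [NumberField K],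
      kolyvagin N W K)
    (hGZK : rank_eq_analyticRank_of_analyticRank_le_one)
    (hWa : waldspurger_exists_heegnerField_twist_ne_zero)
    (hpar : ∀ W : WeierstrassCurve ℚ, W.even_analyticRank_iff)
    (hHP : ∀ (W : WeierstrassCurve ℚ) (K : Type) [Field K] [NumberField K], exists_isHeegnerPoint W K)
    (hup : HeegnerIndexUpperAtTwoHSY)
    {p : ℕ} (hp : p.Prime) (h9 : p % 9 = 4 ∨ p % 9 = 7) (h3 : ¬ ∃ x : ZMod p, x ^ 3 = 3)
    (W : WeierstrassCurve ℚ) [W.IsElliptic] [W.IsGloballyMinimal]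
    (hW : ∃ C : VariableChange ℚ, C • W = cubeSumCurve (p : ℚ)) :
    MissingUpperBoundAt W 2 := by
  obtain ⟨hr, -, -⟩ := X12.CubeSumFamilies.bsdp_three_of_thm14' hHSY hBF hmod hp h9 h3 W hW
  have hcm : W.HasCM := X12.Sylvester.hasCM_of_model W hW
  -- the sign: `r_an = 1` is odd, so `w(W) = -1`
  have hw : W.rootNumber = -1 := by
    rcases W.rootNumber_eq_one_or with hw | hw
    · exact absurd ((hpar W).mpr hw) (by rw [hr]; exact Nat.not_even_one)
    · exact hw
  -- Waldspurger: a Heegner field `K` for `N_W` with rank-zero twin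
  obtain ⟨K, _, _, hKq, hH, hLt⟩ := hWa.exists W hw
  haveI : NeZero (W.conductorNorm ℤ) := ⟨(W.conductorNorm_pos_holds).ne'⟩
  -- a Heegner point over `K`
  obtain ⟨P, Dt, Hg, ι, hP⟩ := hHP W K hKq hH
  -- a globally minimal model of the twin
  have hd : (NumberField.discr K : ℚ) ≠ 0 := by exact_mod_cast NumberField.discr_ne_zero K
  haveI := W.isElliptic_quadraticTwist hd
  obtain ⟨Cd, hCd⟩ := hasGlobalMinimalModel_rat_holds (W.quadraticTwist (NumberField.discr K : ℚ))
  haveI := hCd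
  -- the halvability value of this frame
  obtain ⟨k, hk12, hkiff, -⟩ := missingHalves_two_iff_cmHeegnerIndex W (W.conductorNorm ℤ) K
    Dt Hg ι P (hGZ _ W K) (hKo _ W K) hGZK hmod hBF hcm hKq hH hP hr hLt
    (Cd • W.quadraticTwist (NumberField.discr K : ℚ)) Cd rfl
  exact missingUpperBoundAt_of_upperInstance W (W.conductorNorm ℤ) K Dt Hg ι P (hGZ _ W K) (hKo _ W K)
    hGZK hmod hBF hcm hr hKq hH hP hLt (Cd • W.quadraticTwist (NumberField.discr K : ℚ)) Cd rfl k hk12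
    hkiff (hup p hp h9 h3 W hW (W.conductorNorm ℤ) K Dt Hg ι P _ Cd k hcm hr hKq hH hP hLt rfl hk12 hkiff)

/-- **CONTENT DISCLOSURE: granted the route's support item `PublishedFactsTwo` (19231), the crux
`HeegnerIndexUpperAtTwoHSY` (19229) is EQUIVALENT to the Euler-system half `MissingUpperBoundAt W 2`
(`ord₂ #Ш(W) ≤ ord₂ #Ш_an(W)`) for every globally minimal model `W` of every Sylvester curve of 𝒞_HSY.**
So the crux, fact-free as typed, is neither weaker nor stronger (modulo 19231) than the Kolyvagin
direction of `BSD(E_p, 2)` on the class; its frame quantifier carries no extra content. OPEN AS A CLASS.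
[cite: Kolyvagin1990, Thm. A] [cite: MatarNekovar2019, Thm. 0.3 and §0.11] [cite: Miller2011LMS, Def. 1.1] -/
theorem heegnerIndexUpperAtTwoHSY_iff_missingUpperBoundAt (hF : PublishedFactsTwo) :
    HeegnerIndexUpperAtTwoHSY ↔
      ∀ (p : ℕ), p.Prime → (p % 9 = 4 ∨ p % 9 = 7) → (¬ ∃ x : ZMod p, x ^ 3 = 3) →
        ∀ (W : WeierstrassCurve ℚ) [W.IsElliptic] [W.IsGloballyMinimal],
          (∃ C : VariableChange ℚ, C • W = cubeSumCurve (p : ℚ)) → MissingUpperBoundAt W 2 := by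
  unfold PublishedFactsTwo at hF
  obtain ⟨hHSY, hBF, hmod, -, -, hGZ, hKo, hGZK, hWa, hpar, hHP⟩ := hF
  exact ⟨fun hup p hp h9 h3 W _ _ hW => missingUpperBoundAt_of_heegnerIndexUpperAtTwoHSY hHSY hBF
      hmod hGZ hKo hGZK hWa hpar hHP hup hp h9 h3 W hW,
    fun h => heegnerIndexUpperAtTwoHSY_of_missingUpperBoundAt hGZ hKo hGZK hmod hBF h⟩

/-- **Equivalently, in Miller's currency: granted `PublishedFactsTwo`, the crux ⟺ for every member
`W`, `#Ш_an(W) = q ∈ ℚ` with `ord₂ #Ш(W)[2^∞] ≤ ord₂ q`** (`Ш(W)` is finite by Hu–Shu–Yin Thm 1.3, so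
`ord₂ #Ш(W) = ord₂ #Ш(W)[2^∞]`). [cite: HuShuYin2019, Thm. 1.3 (p. 3)] [cite: Miller2011LMS, Def. 1.1] -/
theorem heegnerIndexUpperAtTwoHSY_iff_shaTwo_le_shaAn (hF : PublishedFactsTwo) :
    HeegnerIndexUpperAtTwoHSY ↔
      ∀ (p : ℕ), p.Prime → (p % 9 = 4 ∨ p % 9 = 7) → (¬ ∃ x : ZMod p, x ^ 3 = 3) →
        ∀ (W : WeierstrassCurve ℚ) [W.IsElliptic] [W.IsGloballyMinimal],
          (∃ C : VariableChange ℚ, C • W = cubeSumCurve (p : ℚ)) →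
            ∃ q : ℚ, shaAn W = (q : ℂ) ∧
              (padicValNat 2 (Nat.card (AddCommGroup.primaryComponent W.sha 2)) : ℤ) ≤ padicValRat 2 q := by
  have hF' := hF
  unfold PublishedFactsTwo at hF'
  obtain ⟨hHSY, hBF, hmod, -⟩ := hF'
  haveI : Fact (2 : ℕ).Prime := ⟨Nat.prime_two⟩
  rw [heegnerIndexUpperAtTwoHSY_iff_missingUpperBoundAt hF]
  refine forall_congr' fun p => forall_congr' fun hp => forall_congr' fun h9 =>
    forall_congr' fun h3 => forall_congr' fun W => forall_congr' fun _ => forall_congr' fun _ =>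
    forall_congr' fun hW => ?_
  haveI : Finite W.sha := (X12.CubeSumFamilies.bsdp_three_of_thm14' hHSY hBF hmod hp h9 h3 W hW).2.1
  simp only [MissingUpperBoundAt, WeierstrassCurve.shaOrder, padicValNat_card_addPrimaryComponent]

end Summit.BirchSwinnertonDyer.BirchSwinnertonDyer.Theorems.SylvesterTwoUpper

end
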